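import Literature.AlgebraicGeometry.AbelianSchemes.IdealTorsionGenericFibreEtale
import Literature.AlgebraicGeometry.AbelianSchemes.SerreTensorPoints
import Literature.Algebra.Module.LinesInRankTwoTorsionModule
import HarnessLib

/-!
# `𝒪`-stable subgroups of the `𝔭`-torsion points ARE the submodules of the `𝔭`-torsion module; with `#A[𝔭](T) = q²` there are exactly `q + 1` of
# order `q` ([Tate1997FiniteFlatGroupSchemes] (3.7); [Hirschfeld1998] §3.1; [AtiyahMacdonald1969] Ch. 2)

Topic `Literature/AlgebraicGeometry/AbelianSchemes`; namespace `Literature.AlgebraicGeometry.AbelianSchemes.AbelianSchemeOver.IdealTorsion` (sequel of ★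
`IdealTorsionGenericFibreEtale` (GF) and ★ `IdealTorsionSubgroupScheme` (S-c)).  THEOREMS ONLY (no definition, no instance, no notation, no named fact, no
`sorry`).  Cell `hodgecm-mathlib` (D-0151), programme P6 «MOD» (crux hLiu418 = stmt-HodgeConjecture-24832, `--supports`, count-neutral): organ **(L-q-sub)
«STABLE SUBGROUPS = SUBMODULES»** (LA1-p04 (g0) 2026-09-02, GENERIC-FIBRE road, default after (GF)): the D-line carrier
`LineOf I y = {H : Subgroup (A_y(Ω)) // Nat.card H = q ∧ (∀ P ∈ H, ∀ a ∈ 𝔭, P ≫ ι(a) = 1) ∧ ∀ a, ∀ P ∈ H, P ≫ ι(a) ∈ H}`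
(`Cruxes/HLiu418/Lines/F0_P6a_DatumOfInputs.lean` :206, `AlgPoints.map φ P = P ≫ φ`) is stated on multiplicative SUBGROUPS of the points group `A(T)`,
while ★ (L-q-lin) `LinesInRankTwoTorsionModule` counts `O`-SUBMODULES of an `O`-module killed by `𝔭`.  This file is the dictionary: through the ★
additive `O`-module of points `act.Pts T = Additive (T ⟶ A)` (`SerreTensorPoints`; `a • x = x ≫ ι(a)`) and its `𝔞`-torsion submodule
`M_𝔞 := torsionBySet O (act.Pts T) 𝔞` (Mathlib), the `ι`-STABLE subgroups of `A(T)` consisting of `𝔞`-torsion points correspond bijectively and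
order-preservingly (same underlying sets, same cardinalities) to the `O`-submodules of `M_𝔞` (§1).  Hence (§2) when `𝔭` is maximal with finite residue
field of order `q` and `#{t ∈ A(T) | 𝔭t = 1} = q²`, there are EXACTLY `q + 1` stable subgroups of order `q` (★ (L-q-lin)
`natCard_submodules_of_isTorsionBySet`), in particular another one besides any given `H₀` (the `htwo` input of ★ SP-SURJ `AdmissibleIdealSpecialFibreSurjective`);
and (§3) with ★ (GF) the count `q²` itself is read off the dock over a local base, giving **`#LineOf = q + 1` DOWN → UP**
(`natCard_stableSubgroups_baseChange_eq_succ_of_forall_iff`).  HC_CM is proved only modulo the printed citations until rung 0 closes; this file is generic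
and changes no count.

THE PRINT.  [Tate1997FiniteFlatGroupSchemes] (3.7): over `k̄` a finite étale group scheme «is» its Galois module of points; subgroup schemes stable under a
ring of endomorphisms `O` are the `O`-submodules.  [AtiyahMacdonald1969] Ch. 2 (pp. 19, 22): a module annihilated by `𝔞` is an `A⧸𝔞`-module, submodules
unchanged.  [Hirschfeld1998] §3.1 Thm. 3.1.1: `PG(1, q)` has `q + 1` points (the `q + 1` lines of the plane `𝔽_q²`).

## Contents (`M_𝔞 := Submodule.torsionBySet O (act.Pts T) ↑𝔞`)
* §1 (any base `S`, any ideal `𝔞`) `mk_mem_torsionBySet_iff` (`mk t ∈ M_𝔞 ↔ ∀ a ∈ 𝔞, t ≫ ι(a) = 1`), `natCard_torsionBySet_pts_eq`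
  (`#M_𝔞 = #{t ∈ A(T) | 𝔞t = 1}`), **`exists_equiv_stableSubgroups`** (`{N ≤ M_𝔞 // #N = r} ≃ {H ≤ A(T) // #H = r ∧ 𝔞H = 1 ∧ ι-stable}`, membership
  `t ∈ e N ↔ mk t ∈ N`), `natCard_stableSubgroups_eq_natCard_submodules`.
* §2 (`𝔭` maximal, `O ⧸ 𝔭` finite) **`natCard_stableSubgroups_eq_succ`** (`#{H // #H = q ∧ 𝔭H = 1 ∧ stable} = q + 1` from `#{t | 𝔭t = 1} = q²`),
  **`exists_stableSubgroup_ne`** (another one besides `H₀`).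
* §3 (local base `R`; with ★ (GF)) **`natCard_stableSubgroups_baseChange_eq_succ_of_forall_iff`** (DOCK FORM: any mono `G′ ↪ A_L` with the kernel-of-`𝔭`
  clause and `dim_L Γ(G′) = q²` gives `q + 1` stable order-`q` subgroups of `𝔭`-torsion points of `A_K(K)`, `K` algebraically closed under `R` with `N ≠ 0`).

## References
* [Tate1997FiniteFlatGroupSchemes] J. Tate, *Finite flat group schemes*, in: Modular Forms and Fermat's Last Theorem (1997), (3.7).
* [AtiyahMacdonald1969] M. F. Atiyah, I. G. Macdonald, *Introduction to Commutative Algebra* (1969), Ch. 2 (pp. 19, 22).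
* [Hirschfeld1998] J. W. P. Hirschfeld, *Projective Geometries over Finite Fields*, 2nd ed. (1998), §3.1 (Thm. 3.1.1).
* [Conrad2004GrossZagier] B. Conrad, *Gross–Zagier revisited*, MSRI Publ. 49 (2004), §7 (the functor of points `A(T)` as an `𝒪`-module).
-/

set_option autoImplicit false

-- Mathlib's `Over`/`Scheme` APIs are stated across semireducible wrappers (as in the ★ `GroupSchemes/*` base-change files).
set_option backward.isDefEq.respectTransparency false

noncomputable section

universe u

open CategoryTheory CategoryTheory.Limits AlgebraicGeometry MonoidalCategory CartesianMonoidalCategory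
open scoped MonObj CategoryTheory.Obj
open Literature.AlgebraicGeometry.GroupSchemes Literature.AlgebraicGeometry.GroupSchemes.GroupSchemeKernel
open Literature.AlgebraicGeometry.GroupSchemes.AffineGroupScheme (Alg)
open Literature.AlgebraicGeometry.Motives (SchemeOver specOver AlgPoints)

namespace Literature.AlgebraicGeometry.AbelianSchemes

namespace AbelianSchemeOver

namespace IdealTorsion

open RingAction

/-! ## §1 Any base: stable subgroups of `𝔞`-torsion points = submodules of the `𝔞`-torsion module -/

section AnyBase

variable {S : Scheme.{u}} {A : AbelianSchemeOver S} {O : Type*} [CommRing O] (act : A.RingAction O) [IsCommMonObj A.X] (𝔞 : Ideal O) (T : Over S)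

/-- A point `t ∈ A(T)` lies in the `𝔞`-torsion submodule `M_𝔞 = A(T)[𝔞]` iff it is killed by `ι(𝔞)`: `mk t ∈ torsionBySet O (act.Pts T) 𝔞 ↔ ∀ a ∈ 𝔞, t ≫ ι(a) = 1`
(`a • mk t = mk (t ≫ ι(a))`, ★ `Pts.smul_mk`). [cite: Conrad2004GrossZagier, §7] [cite: AtiyahMacdonald1969, Ch. 2 (p. 19) and (p. 22)] -/
theorem mk_mem_torsionBySet_iff (t : T ⟶ A.X) :
    Pts.mk act T t ∈ Submodule.torsionBySet O (act.Pts T) (𝔞 : Set O) ↔ ∀ a ∈ 𝔞, t ≫ act.i a = 1 := by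
  rw [Submodule.mem_torsionBySet_iff]
  constructor
  · intro h a ha
    have h1 := h ⟨a, ha⟩
    rw [Pts.smul_mk] at h1
    exact ofMul_eq_zero.1 h1
  · rintro h ⟨a, ha⟩
    change a • Pts.mk act T t = 0
    rw [Pts.smul_mk]
    exact ofMul_eq_zero.2 (h a ha)

/-- **`#A(T)[𝔞] = #{t ∈ A(T) | ι(a)t = 1 ∀ a ∈ 𝔞}`**: the `𝔞`-torsion submodule of the module of points and the `𝔞`-torsion points are the same set
(`x ↦ hom x`). [cite: Conrad2004GrossZagier, §7] [cite: Tate1997FiniteFlatGroupSchemes, (3.7)] -/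
theorem natCard_torsionBySet_pts_eq :
    Nat.card (Submodule.torsionBySet O (act.Pts T) (𝔞 : Set O)) = Nat.card {t : T ⟶ A.X // ∀ a ∈ 𝔞, t ≫ act.i a = 1} := by
  refine Nat.card_congr
    { toFun := fun x => ⟨Pts.hom act T x.1, (mk_mem_torsionBySet_iff act 𝔞 T _).1 (by rw [Pts.mk_hom]; exact x.2)⟩
      invFun := fun t => ⟨Pts.mk act T t.1, (mk_mem_torsionBySet_iff act 𝔞 T t.1).2 t.2⟩
      left_inv := fun x => Subtype.ext (Pts.mk_hom act T x.1)
      right_inv := fun t => Subtype.ext (Pts.hom_mk act T t.1) }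

/-- **STABLE SUBGROUPS OF `𝔞`-TORSION POINTS = SUBMODULES OF THE `𝔞`-TORSION MODULE, WITH THE SAME ORDERS**: for every `r`, the `O`-submodules `N` of
`M_𝔞 = A(T)[𝔞]` with `#N = r` correspond bijectively to the subgroups `H ≤ A(T)` with `#H = r`, consisting of `𝔞`-torsion points and STABLE under every
`ι(a)` — `e N = hom(N)`, `e⁻¹ H = {x ∈ M_𝔞 | hom x ∈ H}` (stability ⇔ closure under `a • x = x ≫ ι(a)`); membership: `t ∈ e N ↔ mk t ∈ N` (as an element
of `M_𝔞`).  This is the dictionary between the D-line carrier `LineOf I y` (subgroups) and ★ (L-q-lin) (submodules).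
[cite: Tate1997FiniteFlatGroupSchemes, (3.7)] [cite: AtiyahMacdonald1969, Ch. 2 (p. 19) and (p. 22)] -/
theorem exists_equiv_stableSubgroups (r : ℕ) :
    ∃ e : {N : Submodule O (Submodule.torsionBySet O (act.Pts T) (𝔞 : Set O)) // Nat.card N = r} ≃
        {H : Subgroup (T ⟶ A.X) // Nat.card H = r ∧ (∀ t ∈ H, ∀ a ∈ 𝔞, t ≫ act.i a = 1) ∧ ∀ a, ∀ t ∈ H, t ≫ act.i a ∈ H},
      ∀ N (t : T ⟶ A.X) (ht : ∀ a ∈ 𝔞, t ≫ act.i a = 1),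
        t ∈ (e N).1 ↔ (⟨Pts.mk act T t, (mk_mem_torsionBySet_iff act 𝔞 T t).2 ht⟩ : Submodule.torsionBySet O (act.Pts T) (𝔞 : Set O)) ∈ N.1 := by
  set M := Submodule.torsionBySet O (act.Pts T) (𝔞 : Set O)
  -- forward: `N ↦ hom(N)`
  let toSub : Submodule O M → Subgroup (T ⟶ A.X) := fun N =>
    { carrier := {t | ∃ x : M, x ∈ N ∧ Pts.hom act T x.1 = t}
      one_mem' := ⟨0, N.zero_mem, Pts.hom_zero act T⟩
      mul_mem' := by
        rintro _ _ ⟨x, hx, rfl⟩ ⟨y, hy, rfl⟩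
        exact ⟨x + y, N.add_mem hx hy, Pts.hom_add act T x.1 y.1⟩
      inv_mem' := by
        rintro _ ⟨x, hx, rfl⟩
        exact ⟨-x, N.neg_mem hx, rfl⟩ }
  have mem_toSub : ∀ (N : Submodule O M) (t : T ⟶ A.X), t ∈ toSub N ↔ ∃ x : M, x ∈ N ∧ Pts.hom act T x.1 = t := fun N t => Iff.rfl
  -- the torsion and stability clauses of `hom(N)`
  have tors_toSub : ∀ (N : Submodule O M), ∀ t ∈ toSub N, ∀ a ∈ 𝔞, t ≫ act.i a = 1 := by
    rintro N _ ⟨x, -, rfl⟩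
    exact (mk_mem_torsionBySet_iff act 𝔞 T _).1 (by rw [Pts.mk_hom]; exact x.2)
  have stab_toSub : ∀ (N : Submodule O M) (a : O), ∀ t ∈ toSub N, t ≫ act.i a ∈ toSub N := by
    rintro N a _ ⟨x, hx, rfl⟩
    exact ⟨a • x, N.smul_mem a hx, Pts.hom_smul act T a x.1⟩
  -- `N ≃ hom(N)`, so the orders agree
  have card_toSub : ∀ N : Submodule O M, Nat.card (toSub N) = Nat.card N := by
    intro N
    symm
    refine Nat.card_congr (Equiv.ofBijective (fun x : N => (⟨Pts.hom act T x.1.1, x.1, x.2, rfl⟩ : toSub N)) ⟨?_, ?_⟩)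
    · intro x y hxy
      have h := congrArg Subtype.val hxy
      exact Subtype.ext (Subtype.ext (Pts.hom_injective act T h))
    · rintro ⟨t, x, hx, rfl⟩
      exact ⟨⟨x, hx⟩, rfl⟩
  -- backward: `H ↦ {x ∈ M | hom x ∈ H}` for an `ι`-stable subgroup `H`
  let ofSub : ∀ (H : Subgroup (T ⟶ A.X)), (∀ a, ∀ t ∈ H, t ≫ act.i a ∈ H) → Submodule O M := fun H hst =>
    { carrier := {x | Pts.hom act T x.1 ∈ H}
      add_mem' := fun {x y} hx hy => by
        change Pts.hom act T (x.1 + y.1) ∈ H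
        rw [Pts.hom_add]
        exact H.mul_mem hx hy
      zero_mem' := by
        change Pts.hom act T (0 : M).1 ∈ H
        rw [Submodule.coe_zero, Pts.hom_zero]
        exact H.one_mem
      smul_mem' := fun a x hx => by
        change Pts.hom act T (a • x).1 ∈ H
        rw [Submodule.coe_smul, Pts.hom_smul]
        exact hst a _ hx }
  have mem_ofSub : ∀ (H : Subgroup (T ⟶ A.X)) (hst : ∀ a, ∀ t ∈ H, t ≫ act.i a ∈ H) (x : M),
      x ∈ ofSub H hst ↔ Pts.hom act T x.1 ∈ H := fun H hst x => Iff.rfl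
  -- `{x ∈ M | hom x ∈ H} ≃ H` for `H` made of `𝔞`-torsion points
  have card_ofSub : ∀ (H : Subgroup (T ⟶ A.X)) (htor : ∀ t ∈ H, ∀ a ∈ 𝔞, t ≫ act.i a = 1)
      (hst : ∀ a, ∀ t ∈ H, t ≫ act.i a ∈ H), Nat.card (ofSub H hst) = Nat.card H := by
    intro H htor hst
    refine Nat.card_congr
      { toFun := fun x => ⟨Pts.hom act T x.1.1, x.2⟩
        invFun := fun t => ⟨⟨Pts.mk act T t.1, (mk_mem_torsionBySet_iff act 𝔞 T t.1).2 (htor t.1 t.2)⟩, by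
          change Pts.hom act T (Pts.mk act T t.1) ∈ H
          rw [Pts.hom_mk]
          exact t.2⟩
        left_inv := fun x => Subtype.ext (Subtype.ext (Pts.mk_hom act T x.1.1))
        right_inv := fun t => Subtype.ext (Pts.hom_mk act T t.1) }
  -- round trips
  have of_to : ∀ N : Submodule O M, ofSub (toSub N) (stab_toSub N) = N := by
    intro N
    ext x
    rw [mem_ofSub _ (stab_toSub N), mem_toSub]
    constructor
    · rintro ⟨y, hy, hyx⟩
      have : y = x := Subtype.ext (Pts.hom_injective act T hyx)
      rw [← this]
      exact hy
    · intro hx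
      exact ⟨x, hx, rfl⟩
  have to_of : ∀ (H : Subgroup (T ⟶ A.X)) (htor : ∀ t ∈ H, ∀ a ∈ 𝔞, t ≫ act.i a = 1)
      (hst : ∀ a, ∀ t ∈ H, t ≫ act.i a ∈ H), toSub (ofSub H hst) = H := by
    intro H htor hst
    ext t
    rw [mem_toSub]
    constructor
    · rintro ⟨x, hx, rfl⟩
      exact (mem_ofSub H hst x).1 hx
    · intro ht
      refine ⟨⟨Pts.mk act T t, (mk_mem_torsionBySet_iff act 𝔞 T t).2 (htor t ht)⟩, ?_, Pts.hom_mk act T t⟩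
      change Pts.hom act T (Pts.mk act T t) ∈ H
      rw [Pts.hom_mk]
      exact ht
  refine ⟨
    { toFun := fun N => ⟨toSub N.1, (card_toSub N.1).trans N.2, tors_toSub N.1, stab_toSub N.1⟩
      invFun := fun H => ⟨ofSub H.1 H.2.2.2, (card_ofSub H.1 H.2.2.1 H.2.2.2).trans H.2.1⟩
      left_inv := fun N => Subtype.ext (of_to N.1)
      right_inv := fun H => Subtype.ext (to_of H.1 H.2.2.1 H.2.2.2) }, fun N t ht => ?_⟩
  change t ∈ toSub N.1 ↔ _
  rw [mem_toSub]
  constructor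
  · rintro ⟨y, hy, hyt⟩
    have : y = ⟨Pts.mk act T t, (mk_mem_torsionBySet_iff act 𝔞 T t).2 ht⟩ :=
      Subtype.ext (Pts.hom_injective act T (by rw [hyt, Pts.hom_mk]))
    rw [← this]
    exact hy
  · intro h
    exact ⟨_, h, Pts.hom_mk act T t⟩

/-- **COUNTING FORM**: for every `r`, the stable subgroups of order `r` of `𝔞`-torsion points and the submodules of order `r` of `A(T)[𝔞]` are
equinumerous. [cite: Tate1997FiniteFlatGroupSchemes, (3.7)] -/
theorem natCard_stableSubgroups_eq_natCard_submodules (r : ℕ) :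
    Nat.card {H : Subgroup (T ⟶ A.X) // Nat.card H = r ∧ (∀ t ∈ H, ∀ a ∈ 𝔞, t ≫ act.i a = 1) ∧ ∀ a, ∀ t ∈ H, t ≫ act.i a ∈ H} =
      Nat.card {N : Submodule O (Submodule.torsionBySet O (act.Pts T) (𝔞 : Set O)) // Nat.card N = r} := by
  obtain ⟨e, -⟩ := exists_equiv_stableSubgroups act 𝔞 T r
  exact Nat.card_congr e.symm

end AnyBase

/-! ## §2 `𝔭` maximal with finite residue field: `#A(T)[𝔭] = q²` gives exactly `q + 1` stable subgroups of order `q` -/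

section Count

variable {S : Scheme.{u}} {A : AbelianSchemeOver S} {O : Type*} [CommRing O] (act : A.RingAction O) [IsCommMonObj A.X]
  (𝔭 : Ideal O) [𝔭.IsMaximal] (T : Over S)

/-- **`q + 1` STABLE SUBGROUPS OF ORDER `q`** (`q = #(O ⧸ 𝔭)` finite): if the `𝔭`-torsion points of `A(T)` number `q²`, then EXACTLY `q + 1` subgroups
`H ≤ A(T)` of order `q` consist of `𝔭`-torsion points and are stable under every `ι(a)` — the `q + 1` lines of the plane `A(T)[𝔭] ≅ 𝔽_q²` (§1 + ★ (L-q-lin)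
`LinesInPlane.natCard_submodules_of_isTorsionBySet`).  For the D-line: `#LineOf I y = q + 1`. [cite: Hirschfeld1998, §3.1 (Thm. 3.1.1)]
[cite: Tate1997FiniteFlatGroupSchemes, (3.7)] [cite: AtiyahMacdonald1969, Ch. 2 (p. 19) and (p. 22)] -/
theorem natCard_stableSubgroups_eq_succ [Finite (O ⧸ 𝔭)]
    (hcard : Nat.card {t : T ⟶ A.X // ∀ a ∈ 𝔭, t ≫ act.i a = 1} = Nat.card (O ⧸ 𝔭) ^ 2) :
    Nat.card {H : Subgroup (T ⟶ A.X) // Nat.card H = Nat.card (O ⧸ 𝔭) ∧ (∀ t ∈ H, ∀ a ∈ 𝔭, t ≫ act.i a = 1) ∧ ∀ a, ∀ t ∈ H, t ≫ act.i a ∈ H} =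
      Nat.card (O ⧸ 𝔭) + 1 := by
  rw [natCard_stableSubgroups_eq_natCard_submodules act 𝔭 T]
  have hq : Nat.card (O ⧸ 𝔭) ≠ 0 := Nat.card_pos.ne'
  have hM : Nat.card (Submodule.torsionBySet O (act.Pts T) (𝔭 : Set O)) = Nat.card (O ⧸ 𝔭) ^ 2 := by
    rw [natCard_torsionBySet_pts_eq, hcard]
  haveI : Finite (Submodule.torsionBySet O (act.Pts T) (𝔭 : Set O)) :=
    Nat.finite_of_card_ne_zero (by rw [hM]; exact pow_ne_zero 2 hq)
  exact Literature.Algebra.Module.LinesInPlane.natCard_submodules_of_isTorsionBySet 𝔭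
    (Submodule.torsionBySet_isTorsionBySet (R := O) (M := act.Pts T) (s := (𝔭 : Set O))) hM

/-- **ANOTHER STABLE SUBGROUP**: under the same hypotheses, for every `H₀` there is a stable subgroup `H ≠ H₀` of order `q` of `𝔭`-torsion points (`q + 1 ≥ 2`)
— the `htwo` input of ★ SP-SURJ `AdmissibleIdealSpecialFibreSurjective` read upstairs. [cite: Hirschfeld1998, §3.1 (Thm. 3.1.1)] [cite: Tate1997FiniteFlatGroupSchemes, (3.7)] -/
theorem exists_stableSubgroup_ne [Finite (O ⧸ 𝔭)]
    (hcard : Nat.card {t : T ⟶ A.X // ∀ a ∈ 𝔭, t ≫ act.i a = 1} = Nat.card (O ⧸ 𝔭) ^ 2) (H₀ : Subgroup (T ⟶ A.X)) :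
    ∃ H : Subgroup (T ⟶ A.X), (Nat.card H = Nat.card (O ⧸ 𝔭) ∧ (∀ t ∈ H, ∀ a ∈ 𝔭, t ≫ act.i a = 1) ∧ ∀ a, ∀ t ∈ H, t ≫ act.i a ∈ H) ∧
      H ≠ H₀ := by
  have h := natCard_stableSubgroups_eq_succ act 𝔭 T hcard
  have hq : Nat.card (O ⧸ 𝔭) ≠ 0 := Nat.card_pos.ne'
  haveI : Finite {H : Subgroup (T ⟶ A.X) // Nat.card H = Nat.card (O ⧸ 𝔭) ∧ (∀ t ∈ H, ∀ a ∈ 𝔭, t ≫ act.i a = 1) ∧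
      ∀ a, ∀ t ∈ H, t ≫ act.i a ∈ H} := Nat.finite_of_card_ne_zero (by rw [h]; exact Nat.succ_ne_zero _)
  have h2 : 1 < Nat.card {H : Subgroup (T ⟶ A.X) // Nat.card H = Nat.card (O ⧸ 𝔭) ∧ (∀ t ∈ H, ∀ a ∈ 𝔭, t ≫ act.i a = 1) ∧
      ∀ a, ∀ t ∈ H, t ≫ act.i a ∈ H} := by
    rw [h]
    omega
  obtain ⟨H₁, H₂, hne⟩ := (Finite.one_lt_card_iff_nontrivial.1 h2).exists_pair_ne
  by_cases h₁ : H₁.1 = H₀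
  · refine ⟨H₂.1, H₂.2, fun h₂ => hne (Subtype.ext (h₁.trans h₂.symm))⟩
  · exact ⟨H₁.1, H₁.2, h₁⟩

end Count

/-! ## §3 DOWN → UP over a local base: `q + 1` lines upstairs from the rank `q²` of the dock -/

section Dock

variable {R : Type u} [CommRing R] {A : AbelianSchemeOver (Spec (.of R))} {O : Type*} [CommRing O] (act : A.RingAction O) [IsCommMonObj A.X]
  {m : ℕ} (E' : Matrix (Fin m) (Fin m) O) (hE' : E' * E' = E') (P : Matrix (Fin m) (Fin 1) O) (Q : Matrix (Fin 1) (Fin m) O) {N : ℕ}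

include hE' in
/-- **DOCK FORM — `#LineOf = q + 1` DOWN → UP**: over a local base `R` with `A[𝔭] = Ker ψ_P` presented by `(E′, P, Q, N)` (★ (S-c)), `𝔭` maximal with
`#(O ⧸ 𝔭) = q` finite, `K` an algebraically closed field under `R` with `N ≠ 0` in `K`, and `L` any field under `R`: if `ι′ : G′ ↪ A_L` is a monomorphism
with the kernel-of-`𝔭` clause (the dock՚s `hkerG₀`, `.symm`) and `dim_L Γ(G′, 𝒪) = q²` (the dock՚s `hrkG₀`), then EXACTLY `q + 1` subgroups of `A_K(K)` of
order `q` consist of `𝔭`-torsion points and are `ι`-stable (★ (GF) `natCard_idealTorsion_algPoints_baseChange_eq_finrank_of_forall_iff` + §2).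
[cite: Tate1997FiniteFlatGroupSchemes, (3.7)] [cite: Hirschfeld1998, §3.1 (Thm. 3.1.1)] [cite: MumfordAV1970, §7 Thm. 4 (p. 72)] -/
theorem natCard_stableSubgroups_baseChange_eq_succ_of_forall_iff [IsLocalRing R] (hP : E' * P = P) (hQ : Q * E' = Q)
    (hQP : Q * P = Matrix.scalar (Fin 1) (N : O)) (hPQ : P * Q = Matrix.scalar (Fin m) (N : O) * E')
    (K : Type u) [Field K] [IsAlgClosed K] [Algebra R K] (hN : (N : K) ≠ 0) (L : Type u) [Field L] [Algebra R L]
    {𝔭 : Ideal O} [𝔭.IsMaximal] [Finite (O ⧸ 𝔭)] (h𝔭 : Ideal.span (Set.range fun k => P k 0) = 𝔭)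
    {G' : SchemeOver L} [IsAffine G'.left] (ι' : G' ⟶ (A.baseChange (Spec.map (CommRingCat.ofHom (algebraMap R L)))).X) [Mono ι']
    (hG' : ∀ ⦃T : SchemeOver L⦄ (t : T ⟶ (A.baseChange (Spec.map (CommRingCat.ofHom (algebraMap R L)))).X),
      (∃ s : T ⟶ G', s ≫ ι' = t) ↔ ∀ a ∈ 𝔭, t ≫ (act.baseChange (Spec.map (CommRingCat.ofHom (algebraMap R L)))).i a = 1)
    (hrk : Module.finrank L (Alg G') = Nat.card (O ⧸ 𝔭) ^ 2) :
    Nat.card {H : Subgroup (AlgPoints (A.baseChange (Spec.map (CommRingCat.ofHom (algebraMap R K)))).X K) //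
        Nat.card H = Nat.card (O ⧸ 𝔭) ∧
        (∀ t ∈ H, ∀ a ∈ 𝔭, t ≫ (act.baseChange (Spec.map (CommRingCat.ofHom (algebraMap R K)))).i a = 1) ∧
        ∀ a, ∀ t ∈ H, t ≫ (act.baseChange (Spec.map (CommRingCat.ofHom (algebraMap R K)))).i a ∈ H} =
      Nat.card (O ⧸ 𝔭) + 1 := by
  haveI : IsCommMonObj (A.baseChange (Spec.map (CommRingCat.ofHom (algebraMap R K)))).X :=
    isCommMonObj_baseChange (Spec.map (CommRingCat.ofHom (algebraMap R K)))
  refine natCard_stableSubgroups_eq_succ (act.baseChange (Spec.map (CommRingCat.ofHom (algebraMap R K)))) 𝔭 (specOver K K) ?_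
  rw [← hrk]
  exact natCard_idealTorsion_algPoints_baseChange_eq_finrank_of_forall_iff act E' P Q hE' hP hQ hQP hPQ K hN L h𝔭 ι' hG'

end Dock

end IdealTorsion

end AbelianSchemeOver

end Literature.AlgebraicGeometry.AbelianSchemes

end
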